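import Summits.Ventures.PercRepro.RankFive
import Summits.Ventures.PercRepro.SignRank
import Summits.Ventures.PercRepro.CodeProfile

/-!
# Piece (H) of the 8-point code bound, wired: `hrank |X| ≤ finrank (span (signVec '' X))`

For a class `X` of 4-subsets of `Fin 8` whose distinct members meet in `2` or `3` points, typer-2's
`finrank_span_signVec_eq_rank_two_add` identifies the dimension of the span of the sign vectors with
`rank (2I + A)`, `A` the «meet in 3» adjacency. Choosing `k ≤ 5` members, the `k × k` principal block of
`2I + A` is the integer matrix `2I + meetMat` cast to `ℝ`, whose meet pattern is the adjacency of some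
edge indicator (`adj5_indOf`, …); `rank5_all` / `rank4_all` / `rank3_all` give a nonsingular principal
minor of size `4` / `3` / `3`, hence `rank ≥ 4` for `|X| ≥ 5`, `≥ 3` for `|X| ≥ 3`
(`le_rank_of_det_submatrix_ne_zero`); `|X| ≤ 2` is direct. This is the hypothesis `hH` of
`codeBound8Fin_of_rank_of_kleitman`.
-/

namespace PercRepro

open Matrix

/-- The meet-3 pattern of `k` chosen members of `X`, as an integer matrix. -/
def meetMat {k : ℕ} (X : Finset (Finset (Fin 8))) (r : Fin k → X) : Matrix (Fin k) (Fin k) ℤ :=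
  Matrix.of fun i j => if i = j then 0 else if ((r i).1 ∩ (r j).1).card = 3 then 1 else 0

/-- The meet matrix is symmetric. -/
theorem meetMat_symm {k : ℕ} (X : Finset (Finset (Fin 8))) (r : Fin k → X) (i j : Fin k) :
    meetMat X r i j = meetMat X r j i := by
  simp only [meetMat, of_apply, Finset.inter_comm]
  by_cases h : i = j
  · subst h; rfl
  · simp [h, Ne.symm h]

/-- Off the diagonal the meet matrix has entries `0` or `1`. -/
theorem meetMat_01 {k : ℕ} (X : Finset (Finset (Fin 8))) (r : Fin k → X) (i j : Fin k) (h : i ≠ j) :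
    meetMat X r i j = 0 ∨ meetMat X r i j = 1 := by
  simp only [meetMat, of_apply, if_neg h]
  split_ifs <;> simp

/-- The meet matrix vanishes on the diagonal. -/
theorem meetMat_diag {k : ℕ} (X : Finset (Finset (Fin 8))) (r : Fin k → X) (i : Fin k) :
    meetMat X r i i = 0 := by
  simp [meetMat]

/-- `2I + B` for an integer matrix `B`, entrywise. -/
def twoPlus {k : ℕ} (B : Matrix (Fin k) (Fin k) ℤ) : Matrix (Fin k) (Fin k) ℤ :=
  Matrix.of fun i j => (if i = j then 2 else 0) + B i j

/-- The real matrix `2I + meet3Adj X` restricted to the chosen members is the cast of `2I + meetMat`. -/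
theorem submatrix_two_add_meet3Adj {k : ℕ} (X : Finset (Finset (Fin 8))) (r : Fin k → X)
    (hr : Function.Injective r) :
    ((2 : ℝ) • (1 : Matrix X X ℝ) + meet3Adj X).submatrix r r =
      (twoPlus (meetMat X r)).map (Int.cast : ℤ → ℝ) := by
  ext i j
  rw [Matrix.submatrix_apply, Matrix.add_apply, Matrix.smul_apply, Matrix.one_apply, Matrix.map_apply]
  simp only [twoPlus, meetMat, meet3Adj, Matrix.of_apply, smul_eq_mul, mul_ite, mul_one, mul_zero]
  by_cases hij : i = j
  · subst hij; simp
  · have hne : r i ≠ r j := fun h => hij (hr h)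
    simp only [hij, hne, ne_eq, not_false_eq_true, true_and, if_false]
    split_ifs <;> simp

/-- `minor5 b v` is the principal submatrix of `2I + adj5 b` with vertex `v` deleted. -/
theorem minor5_eq_submatrix (b : Fin 10 → Bool) (v : Fin 5) :
    minor5 b v = (twoPlus (Matrix.of (adj5 b))).submatrix v.succAbove v.succAbove := by
  ext i j
  simp only [minor5, twoPlus, Matrix.of_apply, Matrix.submatrix_apply]
  congr 1
  by_cases h : i = j
  · subst h; simp
  · have : v.succAbove i ≠ v.succAbove j := fun e => h (Fin.succAbove_right_injective e)
    simp [h, this]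

/-- `minor4 b v` is the principal submatrix of `2·I + A(b)` obtained by deleting row and column `v`. -/
theorem minor4_eq_submatrix (b : Fin 6 → Bool) (v : Fin 4) :
    minor4 b v = (twoPlus (Matrix.of (adj4 b))).submatrix v.succAbove v.succAbove := by
  ext i j
  simp only [minor4, twoPlus, Matrix.of_apply, Matrix.submatrix_apply]
  congr 1
  by_cases h : i = j
  · subst h; simp
  · have : v.succAbove i ≠ v.succAbove j := fun e => h (Fin.succAbove_right_injective e)
    simp [h, this]

/-- `full3 b` is `2·I + A(b)` for the three-vertex graph with edge indicator `b`. -/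
theorem full3_eq (b : Fin 3 → Bool) : full3 b = twoPlus (Matrix.of (adj3 b)) := by
  ext i j
  simp only [full3, twoPlus, Matrix.of_apply]

/-- The determinant of a cast matrix is the cast of the determinant. -/
theorem det_map_intCast {k : ℕ} (B : Matrix (Fin k) (Fin k) ℤ) :
    (B.map (Int.cast : ℤ → ℝ)).det = ((B.det : ℤ) : ℝ) := by
  have := RingHom.map_det (Int.castRingHom ℝ) B
  rw [RingHom.mapMatrix_apply] at this
  exact this.symm

/-- `hrank n ≤ 4`. -/
theorem hrank_le_four (n : ℕ) : hrank n ≤ 4 := by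
  rcases n with _ | _ | _ | _ | _ | _ | n <;> simp [hrank]

/-- Five chosen members force rank `≥ 4`. -/
theorem four_le_rank_of_five (X : Finset (Finset (Fin 8))) (r : Fin 5 → X) (hr : Function.Injective r) :
    4 ≤ ((2 : ℝ) • (1 : Matrix X X ℝ) + meet3Adj X).rank := by
  have hadj : Matrix.of (adj5 (indOf (meetMat X r))) = meetMat X r := by
    have := adj5_indOf (meetMat X r) (meetMat_symm X r) (meetMat_01 X r) (meetMat_diag X r)
    ext i j; rw [Matrix.of_apply]; exact congrFun (congrFun this i) j
  obtain ⟨v, hv⟩ := rank5_all (indOf (meetMat X r))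
  refine le_rank_of_det_submatrix_ne_zero _ (r ∘ v.succAbove) ?_
  rw [← Matrix.submatrix_submatrix, submatrix_two_add_meet3Adj X r hr, Matrix.submatrix_map, ← hadj,
    ← minor5_eq_submatrix, det_map_intCast]
  exact_mod_cast hv

/-- Four chosen members force rank `≥ 3`. -/
theorem three_le_rank_of_four (X : Finset (Finset (Fin 8))) (r : Fin 4 → X) (hr : Function.Injective r) :
    3 ≤ ((2 : ℝ) • (1 : Matrix X X ℝ) + meet3Adj X).rank := by
  have hadj : Matrix.of (adj4 (indOf4 (meetMat X r))) = meetMat X r := by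
    have := adj4_indOf (meetMat X r) (meetMat_symm X r) (meetMat_01 X r) (meetMat_diag X r)
    ext i j; rw [Matrix.of_apply]; exact congrFun (congrFun this i) j
  obtain ⟨v, hv⟩ := rank4_all (indOf4 (meetMat X r))
  refine le_rank_of_det_submatrix_ne_zero _ (r ∘ v.succAbove) ?_
  rw [← Matrix.submatrix_submatrix, submatrix_two_add_meet3Adj X r hr, Matrix.submatrix_map, ← hadj,
    ← minor4_eq_submatrix, det_map_intCast]
  exact_mod_cast hv

/-- Three chosen members force rank `≥ 3`. -/
theorem three_le_rank_of_three (X : Finset (Finset (Fin 8))) (r : Fin 3 → X) (hr : Function.Injective r) :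
    3 ≤ ((2 : ℝ) • (1 : Matrix X X ℝ) + meet3Adj X).rank := by
  have hadj : Matrix.of (adj3 (indOf3 (meetMat X r))) = meetMat X r := by
    have := adj3_indOf (meetMat X r) (meetMat_symm X r) (meetMat_01 X r) (meetMat_diag X r)
    ext i j; rw [Matrix.of_apply]; exact congrFun (congrFun this i) j
  have hv := rank3_all (indOf3 (meetMat X r))
  refine le_rank_of_det_submatrix_ne_zero _ r ?_
  rw [submatrix_two_add_meet3Adj X r hr, ← hadj, ← full3_eq, det_map_intCast]
  exact_mod_cast hv

/-- Two chosen members force rank `≥ 2`. -/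
theorem two_le_rank_of_two (X : Finset (Finset (Fin 8))) (r : Fin 2 → X) (hr : Function.Injective r) :
    2 ≤ ((2 : ℝ) • (1 : Matrix X X ℝ) + meet3Adj X).rank := by
  refine le_rank_of_det_submatrix_ne_zero _ r ?_
  rw [submatrix_two_add_meet3Adj X r hr, det_map_intCast]
  have h01 := meetMat_01 X r 0 1 (by decide)
  have hs := meetMat_symm X r 1 0
  rw [Matrix.det_fin_two]
  simp only [twoPlus, Matrix.of_apply, meetMat_diag]
  rcases h01 with h | h <;> simp [h, hs]

/-- One chosen member forces rank `≥ 1`. -/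
theorem one_le_rank_of_one (X : Finset (Finset (Fin 8))) (r : Fin 1 → X) :
    1 ≤ ((2 : ℝ) • (1 : Matrix X X ℝ) + meet3Adj X).rank := by
  refine le_rank_of_det_submatrix_ne_zero _ r ?_
  rw [Matrix.det_fin_one, Matrix.submatrix_apply, Matrix.add_apply, Matrix.smul_apply, Matrix.one_apply]
  simp [meet3Adj]

/-- **Piece (H), wired**: the hypothesis `hH` of `codeBound8Fin_of_rank_of_kleitman`. -/
theorem hrank_le_finrank_span_signVec (X : Finset (Finset (Fin 8))) (hX : ∀ σ ∈ X, σ.card = 4)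
    (hmeet : ∀ σ ∈ X, ∀ τ ∈ X, σ ≠ τ → (σ ∩ τ).card = 2 ∨ (σ ∩ τ).card = 3) :
    hrank X.card ≤ Module.finrank ℝ (Submodule.span ℝ (signVec '' (X : Set (Finset (Fin 8))))) := by
  classical
  rw [finrank_span_signVec_eq_rank_two_add X hX hmeet]
  have hcard : Fintype.card X = X.card := Fintype.card_coe X
  have emb : ∀ k : ℕ, k ≤ X.card → ∃ r : Fin k → X, Function.Injective r := by
    intro k hk
    obtain ⟨f⟩ := Function.Embedding.nonempty_of_card_le (α := Fin k) (β := X)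
      (by rw [Fintype.card_fin, hcard]; exact hk)
    exact ⟨f, f.injective⟩
  rcases Nat.lt_or_ge X.card 5 with h5 | h5
  · interval_cases hc : X.card
    · simp [hrank]
    · obtain ⟨r, -⟩ := emb 1 (by omega); simpa [hrank] using one_le_rank_of_one X r
    · obtain ⟨r, hr⟩ := emb 2 (by omega); simpa [hrank] using two_le_rank_of_two X r hr
    · obtain ⟨r, hr⟩ := emb 3 (by omega); simpa [hrank] using three_le_rank_of_three X r hr
    · obtain ⟨r, hr⟩ := emb 4 (by omega); simpa [hrank] using three_le_rank_of_four X r hr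
  · obtain ⟨r, hr⟩ := emb 5 h5
    exact (hrank_le_four _).trans (four_le_rank_of_five X r hr)

end PercRepro
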